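/-
Copyright: the b2b-balaban T⁴-continuum CRUX team, row NE7b leaf lineage `t4-ne7b-formalise-leaf-05` (gen 160). Project licence.
-/
import Summits.QuantumFields.BalabanUV.T4Continuum.Spine.NE7b.BlockAverageKernelFloor
import Summits.QuantumFields.BalabanUV.T4Continuum.Spine.NE7b.QuadraticFibreMinimiser
import Summits.QuantumFields.BalabanUV.T4Continuum.Spine.NE7b.HardStepMonotone

/-!
# THE CRITICAL SECTION OF PRINT's BLOCK AVERAGE ON THE TORUS: for the `η^d`-weighted fine Dirichlet form `Q` on
# `E = EuclideanSpace ℝ (Tor (fine n M))` and print's block average `D = Q′_n` (`B5Block118.QsOp`, ANY side `n ≥ 1`), `Q` is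
# `(2∕n^d)`-coercive on `ker D` and symmetric, so `…QuadraticFibreMinimiser`'s propagator EXISTS: a continuous linear right inverse
# `H` of `D` whose values are `Q`-orthogonal to `ker D` — the MINIMISING section, along which the transported form
# `Q.bilinearComp H H` is the LEAST transported form (`≤ Q.bilinearComp T T` for every section `T`) and equals the constrained
# infimum `⨅_{D x = g} Q x x`; at every composite level `n` on `Tor (fine n (fine L M′))` this EFFECTIVE form of the free scalar hard
# step has the floor `2∕L²` on `ker Q′_L` (`…BlockAverageKernelFloor`) and dominates the unit-lattice Dirichlet form
# (`…BlockAverageDirichletDomination`, `γ₀ = 1`), and `…HardStepMonotone`'s reference-flow floor letter is INHABITED on print's torus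
# (row NE7b, node U5c; [folklore] over the tree's kernel theorems BY NAME — the end of BAKF §4 it names «NOT HERE»)

Cell `pub-balaban`, sub-cell `t4`, spine estimate NE7b (`T4WeightBudget.RelWeightBound`; the cell's OWN estimate — NOT PRINTED in
[Bałaban 1983–89], NOT PROVED).  Crux-route work under `Spine/NE7b/` by a row leaf (`t4-ne7b-formalise-leaf-05` gen 160) under FREEZE (0)'s
crux-prover clause; the third file of this lineage's hard-flow packet (BADD `…BlockAverageDirichletDomination` = DMT's `hRQ`, `γ = 1`;
BAKF `…BlockAverageKernelFloor` = DMT's `hR`, `m = 2∕L²`, and the per-scale reset along ANY section).  NOTHING of Bałaban's is asserted: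
the inputs are the tree's KERNEL theorems BY NAME — BAKF `kernelFloor_dot` (the block Poincaré floor on `ker Q′_n`, from NE2's
`…Support.ScalarBlockPoincareLocal`), `hardFlow_nextFloor_of_section`, `exists_blockConstant_section`; BADD `fine_form_eq`, `coarse_form_eq`,
`transported_dominates_of_section`; leaf-03's QFM `…QuadraticFibreMinimiser` (`exists_propagator`, `propagator_unique`, `le_of_orthogonal_ker`,
`form_split`: Lax–Milgram on the closed subspace `ker D`); leaf-06's HSMO `…HardStepMonotone.kerCoercive_of_dominates_reference`;
`…MatrixFormJunction` (37) (`kerCoercive_transfer`).  No `T4Continuum/Support` leaf typed; no `def`; zero `sorry`.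

WHY.  The hard-step cell carries the free Gaussian flow as a REFERENCE: HSMO's `transported_ge_of_dominates` ∕
`kerCoercive_of_dominates_reference` read the interacting form `V` against the reference form `P` through `P`'s OWN hard step
`P⁺ = P.bilinearComp H H`, `H` the `P`-critical section (the fibre minimiser of `P`-energy: QFM), and ask for `P⁺`'s floor on the next
kernel.  For the free scalar flow on print's torus BADD and BAKF supplied the two DMT letters and the floor `2∕L²` along ANY section of
`Q′_n`, inhabiting the section slot with the block-constant extension `T₀` only — along which the transported form is the crude `n·R`;
the section along which `Q.bilinearComp T T` IS the effective form of the step (print's «`H_kB` is a minimum of `½⟨∂A, ∂A⟩` on the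
hyperplane `{A : Q_kA = B}`», [B5] p. 29, here for the SCALAR average on the torus in CLM currency) was left «NOT HERE» (BAKF's docstring;
PRICING-NE7b v132 §3: «hard-flow sub-limb: BADD ✓ + BAKF ✓ … minimising section NOT HERE»).  It costs one letter: QFM's propagator needs
`Q` coercive on `ker D` ONLY — and on `ker Q′_n` the fine form IS coercive, by BAKF's own kernel floor read at side `n` (`Q′_n v = 0 ⟹
(2∕n²)·(v ⬝ v) ≤ v ⬝ (S₁ v)` for the unit-difference Dirichlet matrix `S₁` of the fine torus) and the scaling `Q = η^{d−2}·S₁`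
(`∂^η = n·∂₁`): `m = 2∕n^d = 2η^d` in `E`'s norm.  With `M := T₀` as the auxiliary right inverse, QFM gives `H`; QFM's
`le_of_orthogonal_ker` makes `Q.bilinearComp H H` the least transported form and `form_split` makes its pullback dominated by `Q`
(the effective form is itself a DMT model form, `γ = 1`); BAKF ∕ BADD along `T := H` give its floor and lower domination at every
composite level; and HSMO's `hcoP` is inhabited: an interacting form `V ≥ γ₀·Q` has next floor `γ₀·2∕L²` along ANY section.

WHAT IS PROVED ([folklore]; `n ≥ 1` via `[NeZero n]`, `M : Fin d → ℕ` with `M μ ≥ 1`, any `d`; `E = EuclideanSpace ℝ (Tor (fine n M))`,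
`F = EuclideanSpace ℝ (Tor M)`; `Q`, `D` characterised in coordinates by BADD's `A = η^d·(reM ∂^η)ᵀ(reM ∂^η)` and `reM Q′_n` — the
hypotheses `hQ`, `hD` of BADD ∕ BAKF VERBATIM):
* §1 THE QFM LETTERS OF THE FINE FORM: `fine_dot_eq_smul_unit_dot` (`v ⬝ (A v) = (n²∕n^d)·(v ⬝ (S₁ v))`), **`fineForm_kerCoercive_dot`**
  (`reM Q′_n v = 0 ⟹ (2∕n^d)·(v ⬝ v) ≤ v ⬝ (A v)`), **`fineForm_kerCoercive`** (CLM: `D κ = 0 ⟹ (2∕n^d)‖κ‖² ≤ Q κ κ` — QFM's `hco`),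
  `form_symm_of_transpose`, `fineMatrix_transpose`, **`fineForm_symm`**, `fineForm_nonneg`, `two_div_pow_pos`.
* §2 THE CRITICAL SECTION: **`exists_criticalSection`** (`∃ H : F →L E`, `D (H g) = g`, `∀ g κ, D κ = 0 → Q (H g) κ = 0` — QFM
  `exists_propagator` with `M :=` BAKF's `T₀`), **`criticalSection_unique`**, `criticalSection_form_split`
  (`Q x x = Q (HDx)(HDx) + Q (x − HDx)(x − HDx)`), **`effective_pullback_le`** (`(Q.bilinearComp H H) (D x) (D x) ≤ Q x x` — DMT's `hRQ`
  shape for the effective form, `γ = 1`).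
* §3 LEAST ENERGY: **`critical_le_transported`** (`(Q.bilinearComp H H) g g ≤ (Q.bilinearComp T T) g g` for EVERY section `T`),
  `critical_le_of_fibre` (`≤ Q x x` whenever `D x = g`), **`critical_eq_iInf`** (`(Q.bilinearComp H H) g g = ⨅ x : {x ∕∕ D x = g}, Q x x`
  — `…ConstrainedSchurForm`'s constrained infimum, attained).
* §4 THE REFERENCE FLOW's LETTERS BY VALUE ON `Tor (fine n (fine L M′))` (ANY `n` — the composite `L^k`; `R` = unit-lattice Dirichlet form
  on `F = EuclideanSpace ℝ (Tor (fine L M′))`, `D₂` = `Q′_L` in coordinates, BAKF's `hR` ∕ `hD₂` VERBATIM): **`exists_criticalSection_letters`**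
  (`∃ H` critical with `D₂ g = 0 → (2∕L²)‖g‖² ≤ (Q.bilinearComp H H) g g`, `R g g ≤ (Q.bilinearComp H H) g g`, least energy against every
  section), `criticalFlow_nextFloor` (for a GIVEN section), `exists_criticalFlow_letters` (all five maps exist).
* §5 HSMO's REFERENCE LETTER INHABITED: **`interacting_nextFloor_of_domination`** — for ANY continuous bilinear form `V` on `E` with
  `γ₀·Q v v ≤ V v v` (`0 ≤ γ₀`) and ANY section `T` of `D`: `D₂ g = 0 ⟹ γ₀·(2∕L²)·‖g‖² ≤ (V.bilinearComp T T) g g`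
  (`…HardStepMonotone.kerCoercive_of_dominates_reference` with `P := Q`, `H :=` §2, `hcoP :=` §4; honest: DMT's pullback route
  (`…HardStepMonotone.dominates_trans` + BAKF) gives the same number without `H` — `H` is what the UPPER half and the effective form need).
* §6 toy: `m = 2∕n^d` is `1∕8` at `n = 2`, `d = 4`; the next floor `γ₀·2∕L²` is `γ₀∕2` at `L = 2`.

NOT HERE (honest): the UNIFORM CEILING of the effective form (print's (1.67) RIGHT half for the scalar torus flow, `(Q.bilinearComp H H) g g ≤
γ₁(d)·R g g`, `γ₁` free of `n` — in the tree on `ℤ^d` (`B5Ineq167UpperZd` ∕ `…SharpUpperZd`, `…FreeFieldBlockingLetters`) and for the VECTOR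
torus operator (`B5Eq166GaussDeltaK.ineq167_DeltaK_sharp`), not for BADD's scalar torus objects; §3's `≤ Q (T₀ g)(T₀ g)` grows like `n`);
`H` as a periodisation of `B5Hk103ScalarZd.kerH` (the OWNER's (55)); the sharp kernel constant (BAKF `_sharp`, a drop-in for §1); the
`ℓ²(ℤ^d)` carrier; covariant `U ≠ 1`; anything of Bałaban's small-field action ((A3) ∕ (A1c), NC-NE7b-α UNRULED).  BY-NAME EFFECT ON THE
WALL: NONE (the hard-step cell's reference section and HSMO's `hcoP` inhabited for the free scalar flow on print's torus; the wall is (R2)).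
NE7b NOT PRINTED ∕ NOT PROVED; spine PROVED 0∕9; rung (B)+1 on a FINITE torus — NOT infinite volume, NOT the mass gap, NOT Clay.  HONEST
DEPENDENCY: continuum YM on T⁴ ⇐ BetaPertH ∧ nine spine estimates (0∕9 proved); BetaPertH ⇐ (D1) ∧ (D4) ∧ CAP+tail; G-an2-4 gates asym,
D1 and NE2∕3∕4.
-/

set_option autoImplicit false

namespace Summit.QuantumFields.BalabanUV.T4Continuum.NE7b.BlockAverageCriticalSection

open Matrix WithLp Finset
open Literature.MathematicalPhysics.QuantumFieldTheory.Balaban1983to89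
open B5Prop11Plancherel (Tor fine)
open B5Action121 (GradOp)
open B5Block118 (QsOp)
open B5RealFields (reM)
open Summit.QuantumFields.BalabanUV.T4Continuum.NE7b.MatrixFormJunction (kerCoercive_transfer)
open Summit.QuantumFields.BalabanUV.T4Continuum.NE7b.QuadraticFibreMinimiser
  (exists_propagator propagator_unique le_of_orthogonal_ker form_split)
open Summit.QuantumFields.BalabanUV.T4Continuum.NE7b.HardStepMonotone (kerCoercive_of_dominates_reference)
open Summit.QuantumFields.BalabanUV.T4Continuum.NE7b.BlockAverageDirichletDomination
  (dot_transpose_mul_self fine_form_eq coarse_form_eq transported_dominates_of_section)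
open Summit.QuantumFields.BalabanUV.T4Continuum.NE7b.BlockAverageKernelFloor
  (kernelFloor_dot hardFlow_nextFloor_of_section exists_blockConstant_section)

variable {d : ℕ} (n : ℕ) [NeZero n] (M : Fin d → ℕ) [hM : ∀ μ, NeZero (M μ)]

/-! ## §1. The QFM letters of the fine form: kernel coercivity `2∕n^d` on `ker Q′_n`, symmetry, positivity -/

/-- THE SCALING `Q = η^{d−2}·S₁`: `v ⬝ (A v) = (n²∕n^d)·(v ⬝ (S₁ v))` with `A = η^d·(reM ∂^η)ᵀ(reM ∂^η)` (`∂^η = n·∂₁` on `T_η`) and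
`S₁ = (reM ∂₁)ᵀ(reM ∂₁)` the unit-difference Dirichlet matrix of the fine torus (BADD `fine_form_eq` ∕ `coarse_form_eq` BY NAME). [folklore] -/
theorem fine_dot_eq_smul_unit_dot (v : Tor (fine n M) → ℝ) :
    v ⬝ᵥ (((1 / (n : ℝ) ^ d) • ((reM (GradOp (fine n M) (n : ℂ)))ᵀ * reM (GradOp (fine n M) (n : ℂ)))) *ᵥ v)
      = (n : ℝ) ^ 2 / (n : ℝ) ^ d * (v ⬝ᵥ (((reM (GradOp (fine n M) 1))ᵀ * reM (GradOp (fine n M) 1)) *ᵥ v)) := by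
  rw [fine_form_eq n M v, coarse_form_eq (fine n M) v, Finset.mul_sum, Finset.mul_sum]
  refine Finset.sum_congr rfl fun x _ => ?_
  rw [Finset.mul_sum, Finset.mul_sum]
  refine Finset.sum_congr rfl fun μ _ => ?_
  ring

omit hM in
/-- `0 < 2∕n^d`. -/
theorem two_div_pow_pos : (0 : ℝ) < 2 / (n : ℝ) ^ d := by
  have hn : (0 : ℝ) < n := by exact_mod_cast Nat.pos_of_ne_zero (NeZero.ne n)
  positivity

/-- **THE FINE FORM IS COERCIVE ON `ker Q′_n`, REAL `dotProduct` CURRENCY** — the hypothesis `h` of `…MatrixFormJunction.kerCoercive_transfer`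
with `Dm = reM Q′_n` and BADD's fine matrix `A`: `reM Q′_n v = 0 ⟹ (2∕n^d)·(v ⬝ v) ≤ v ⬝ (A v)` (BAKF `kernelFloor_dot` at side `n`, times
`n²∕n^d`). [folklore] -/
theorem fineForm_kerCoercive_dot (v : Tor (fine n M) → ℝ) (hv : reM (QsOp n M) *ᵥ v = 0) :
    2 / (n : ℝ) ^ d * (v ⬝ᵥ v)
      ≤ v ⬝ᵥ (((1 / (n : ℝ) ^ d) • ((reM (GradOp (fine n M) (n : ℂ)))ᵀ * reM (GradOp (fine n M) (n : ℂ)))) *ᵥ v) := by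
  have hn : (0 : ℝ) < n := by exact_mod_cast Nat.pos_of_ne_zero (NeZero.ne n)
  have h := kernelFloor_dot n M v hv
  have hc : (0 : ℝ) ≤ (n : ℝ) ^ 2 / (n : ℝ) ^ d := by positivity
  rw [fine_dot_eq_smul_unit_dot]
  have e : 2 / (n : ℝ) ^ d * (v ⬝ᵥ v) = (n : ℝ) ^ 2 / (n : ℝ) ^ d * (2 / (n : ℝ) ^ 2 * (v ⬝ᵥ v)) := by
    field_simp
  rw [e]
  exact mul_le_mul_of_nonneg_left h hc

/-- **QFM's `hco` ON PRINT's TORUS**: for `Q`, `D` characterised in coordinates by BADD's fine matrix and `reM Q′_n`,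
`∀ κ, D κ = 0 → (2∕n^d)·‖κ‖² ≤ Q κ κ`. [folklore] -/
theorem fineForm_kerCoercive
    {Q : EuclideanSpace ℝ (Tor (fine n M)) →L[ℝ] EuclideanSpace ℝ (Tor (fine n M)) →L[ℝ] ℝ}
    {D : EuclideanSpace ℝ (Tor (fine n M)) →L[ℝ] EuclideanSpace ℝ (Tor M)}
    (hQ : ∀ x y, Q x y = ofLp x ⬝ᵥ
      (((1 / (n : ℝ) ^ d) • ((reM (GradOp (fine n M) (n : ℂ)))ᵀ * reM (GradOp (fine n M) (n : ℂ)))) *ᵥ ofLp y))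
    (hD : ∀ x, ofLp (D x) = reM (QsOp n M) *ᵥ ofLp x) :
    ∀ κ, D κ = 0 → 2 / (n : ℝ) ^ d * ‖κ‖ ^ 2 ≤ Q κ κ :=
  fun κ hκ => kerCoercive_transfer hQ hD (fineForm_kerCoercive_dot n M) κ hκ

omit hM in
/-- A matrix form with a symmetric matrix is a symmetric bilinear form. [folklore] -/
theorem form_symm_of_transpose {ι : Type*} [Fintype ι]
    {Q : EuclideanSpace ℝ ι →L[ℝ] EuclideanSpace ℝ ι →L[ℝ] ℝ} {A : Matrix ι ι ℝ}
    (hQ : ∀ x y, Q x y = ofLp x ⬝ᵥ (A *ᵥ ofLp y)) (hA : Aᵀ = A) (x y : EuclideanSpace ℝ ι) : Q x y = Q y x := by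
  rw [hQ, hQ, Matrix.dotProduct_mulVec, ← Matrix.mulVec_transpose, hA, dotProduct_comm]

/-- BADD's fine matrix is symmetric: `(η^d·(reM ∂^η)ᵀ(reM ∂^η))ᵀ = η^d·(reM ∂^η)ᵀ(reM ∂^η)`. [folklore] -/
theorem fineMatrix_transpose :
    (((1 / (n : ℝ) ^ d) • ((reM (GradOp (fine n M) (n : ℂ)))ᵀ * reM (GradOp (fine n M) (n : ℂ)))))ᵀ
      = (1 / (n : ℝ) ^ d) • ((reM (GradOp (fine n M) (n : ℂ)))ᵀ * reM (GradOp (fine n M) (n : ℂ))) := by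
  rw [Matrix.transpose_smul, Matrix.transpose_mul, Matrix.transpose_transpose]

/-- **THE FINE FORM IS SYMMETRIC** (QFM's `hsymm`, HSMO's `hPsymm`). [folklore] -/
theorem fineForm_symm
    {Q : EuclideanSpace ℝ (Tor (fine n M)) →L[ℝ] EuclideanSpace ℝ (Tor (fine n M)) →L[ℝ] ℝ}
    (hQ : ∀ x y, Q x y = ofLp x ⬝ᵥ
      (((1 / (n : ℝ) ^ d) • ((reM (GradOp (fine n M) (n : ℂ)))ᵀ * reM (GradOp (fine n M) (n : ℂ)))) *ᵥ ofLp y))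
    (x y : EuclideanSpace ℝ (Tor (fine n M))) : Q x y = Q y x :=
  form_symm_of_transpose hQ (fineMatrix_transpose n M) x y

/-- THE FINE FORM IS NONNEGATIVE: `0 ≤ Q x x` (a weighted sum of squares). [folklore] -/
theorem fineForm_nonneg
    {Q : EuclideanSpace ℝ (Tor (fine n M)) →L[ℝ] EuclideanSpace ℝ (Tor (fine n M)) →L[ℝ] ℝ}
    (hQ : ∀ x y, Q x y = ofLp x ⬝ᵥ
      (((1 / (n : ℝ) ^ d) • ((reM (GradOp (fine n M) (n : ℂ)))ᵀ * reM (GradOp (fine n M) (n : ℂ)))) *ᵥ ofLp y))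
    (x : EuclideanSpace ℝ (Tor (fine n M))) : 0 ≤ Q x x := by
  rw [hQ, Matrix.smul_mulVec, dotProduct_smul, smul_eq_mul, dot_transpose_mul_self]
  exact mul_nonneg (by positivity) (Finset.sum_nonneg fun i _ => sq_nonneg _)

/-! ## §2. The critical section of print's block average -/

/-- **THE CRITICAL SECTION EXISTS.**  For `Q`, `D` characterised in coordinates by BADD's fine matrix and `reM Q′_n` there is a continuous
linear right inverse `H : F →L E` of `D` whose values are `Q`-orthogonal to `ker D`: `D (H g) = g` and `Q (H g) κ = 0` whenever `D κ = 0`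
— `…QuadraticFibreMinimiser.exists_propagator` (Lax–Milgram on `ker D`) with §1's `hco` (`m = 2∕n^d`) and BAKF's block-constant section
`T₀` as the auxiliary right inverse. [folklore] -/
theorem exists_criticalSection
    {Q : EuclideanSpace ℝ (Tor (fine n M)) →L[ℝ] EuclideanSpace ℝ (Tor (fine n M)) →L[ℝ] ℝ}
    {D : EuclideanSpace ℝ (Tor (fine n M)) →L[ℝ] EuclideanSpace ℝ (Tor M)}
    (hQ : ∀ x y, Q x y = ofLp x ⬝ᵥ
      (((1 / (n : ℝ) ^ d) • ((reM (GradOp (fine n M) (n : ℂ)))ᵀ * reM (GradOp (fine n M) (n : ℂ)))) *ᵥ ofLp y))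
    (hD : ∀ x, ofLp (D x) = reM (QsOp n M) *ᵥ ofLp x) :
    ∃ H : EuclideanSpace ℝ (Tor M) →L[ℝ] EuclideanSpace ℝ (Tor (fine n M)),
      (∀ g, D (H g) = g) ∧ (∀ g κ, D κ = 0 → Q (H g) κ = 0) := by
  obtain ⟨T₀, -, hT₀⟩ := exists_blockConstant_section n M hD
  obtain ⟨H, hH, hHo, -⟩ := exists_propagator (Q := Q) hT₀ (two_div_pow_pos (d := d) n) (fineForm_kerCoercive n M hQ hD)
  exact ⟨H, hH, hHo⟩

/-- **THE CRITICAL SECTION IS UNIQUE**: two continuous linear right inverses of `D` with `Q`-orthogonal values coincide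
(`…QuadraticFibreMinimiser.propagator_unique`). [folklore] -/
theorem criticalSection_unique
    {Q : EuclideanSpace ℝ (Tor (fine n M)) →L[ℝ] EuclideanSpace ℝ (Tor (fine n M)) →L[ℝ] ℝ}
    {D : EuclideanSpace ℝ (Tor (fine n M)) →L[ℝ] EuclideanSpace ℝ (Tor M)}
    (hQ : ∀ x y, Q x y = ofLp x ⬝ᵥ
      (((1 / (n : ℝ) ^ d) • ((reM (GradOp (fine n M) (n : ℂ)))ᵀ * reM (GradOp (fine n M) (n : ℂ)))) *ᵥ ofLp y))
    (hD : ∀ x, ofLp (D x) = reM (QsOp n M) *ᵥ ofLp x)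
    {H H' : EuclideanSpace ℝ (Tor M) →L[ℝ] EuclideanSpace ℝ (Tor (fine n M))}
    (hH : ∀ g, D (H g) = g) (hHo : ∀ g κ, D κ = 0 → Q (H g) κ = 0)
    (hH' : ∀ g, D (H' g) = g) (hH'o : ∀ g κ, D κ = 0 → Q (H' g) κ = 0) : H = H' :=
  propagator_unique (two_div_pow_pos (d := d) n) (fineForm_kerCoercive n M hQ hD) hH hHo hH' hH'o

/-- THE FORM SPLITS ALONG THE CHART `x = H(Dx) + (x − H(Dx))`: `Q x x = Q (HDx)(HDx) + Q (x − HDx)(x − HDx)`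
(`…QuadraticFibreMinimiser.form_split`, symmetry from §1). [folklore] -/
theorem criticalSection_form_split
    {Q : EuclideanSpace ℝ (Tor (fine n M)) →L[ℝ] EuclideanSpace ℝ (Tor (fine n M)) →L[ℝ] ℝ}
    {D : EuclideanSpace ℝ (Tor (fine n M)) →L[ℝ] EuclideanSpace ℝ (Tor M)}
    (hQ : ∀ x y, Q x y = ofLp x ⬝ᵥ
      (((1 / (n : ℝ) ^ d) • ((reM (GradOp (fine n M) (n : ℂ)))ᵀ * reM (GradOp (fine n M) (n : ℂ)))) *ᵥ ofLp y))
    {H : EuclideanSpace ℝ (Tor M) →L[ℝ] EuclideanSpace ℝ (Tor (fine n M))}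
    (hH : ∀ g, D (H g) = g) (hHo : ∀ g κ, D κ = 0 → Q (H g) κ = 0) (x : EuclideanSpace ℝ (Tor (fine n M))) :
    Q x x = Q (H (D x)) (H (D x)) + Q (x - H (D x)) (x - H (D x)) :=
  form_split (fineForm_symm n M hQ) hH hHo x

/-- **THE EFFECTIVE FORM's PULLBACK IS DOMINATED BY THE FINE FORM**: `(Q.bilinearComp H H) (D x) (D x) ≤ Q x x` for every `x` — the
effective form of the step is itself a DMT model form for the fine form (`…DominationTransfer`'s `hRQ` shape with `R := Q.bilinearComp H H`,
`γ = 1`). [folklore] -/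
theorem effective_pullback_le
    {Q : EuclideanSpace ℝ (Tor (fine n M)) →L[ℝ] EuclideanSpace ℝ (Tor (fine n M)) →L[ℝ] ℝ}
    {D : EuclideanSpace ℝ (Tor (fine n M)) →L[ℝ] EuclideanSpace ℝ (Tor M)}
    (hQ : ∀ x y, Q x y = ofLp x ⬝ᵥ
      (((1 / (n : ℝ) ^ d) • ((reM (GradOp (fine n M) (n : ℂ)))ᵀ * reM (GradOp (fine n M) (n : ℂ)))) *ᵥ ofLp y))
    {H : EuclideanSpace ℝ (Tor M) →L[ℝ] EuclideanSpace ℝ (Tor (fine n M))}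
    (hH : ∀ g, D (H g) = g) (hHo : ∀ g κ, D κ = 0 → Q (H g) κ = 0) (x : EuclideanSpace ℝ (Tor (fine n M))) :
    (Q.bilinearComp H H) (D x) (D x) ≤ Q x x := by
  rw [ContinuousLinearMap.bilinearComp_apply, criticalSection_form_split n M hQ hH hHo x]
  exact le_add_of_nonneg_right (fineForm_nonneg n M hQ _)

/-! ## §3. Least energy: the transported form along `H` is the effective (Schur) form -/

/-- `(Q.bilinearComp H H) g g ≤ Q x x` for every `x` on the fibre `D x = g` (`…QuadraticFibreMinimiser.le_of_orthogonal_ker`). [folklore] -/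
theorem critical_le_of_fibre
    {Q : EuclideanSpace ℝ (Tor (fine n M)) →L[ℝ] EuclideanSpace ℝ (Tor (fine n M)) →L[ℝ] ℝ}
    {D : EuclideanSpace ℝ (Tor (fine n M)) →L[ℝ] EuclideanSpace ℝ (Tor M)}
    (hQ : ∀ x y, Q x y = ofLp x ⬝ᵥ
      (((1 / (n : ℝ) ^ d) • ((reM (GradOp (fine n M) (n : ℂ)))ᵀ * reM (GradOp (fine n M) (n : ℂ)))) *ᵥ ofLp y))
    {H : EuclideanSpace ℝ (Tor M) →L[ℝ] EuclideanSpace ℝ (Tor (fine n M))}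
    (hH : ∀ g, D (H g) = g) (hHo : ∀ g κ, D κ = 0 → Q (H g) κ = 0)
    (g : EuclideanSpace ℝ (Tor M)) {x : EuclideanSpace ℝ (Tor (fine n M))} (hx : D x = g) :
    (Q.bilinearComp H H) g g ≤ Q x x := by
  rw [ContinuousLinearMap.bilinearComp_apply]
  exact le_of_orthogonal_ker (fineForm_symm n M hQ) (fun κ _ => fineForm_nonneg n M hQ κ) (hx.trans (hH g).symm) (hHo g)

/-- **LEAST ENERGY**: along the critical section the transported form is the least transported form — `(Q.bilinearComp H H) g g ≤
(Q.bilinearComp T T) g g` for EVERY continuous right inverse `T` of `D`. [folklore] -/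
theorem critical_le_transported
    {Q : EuclideanSpace ℝ (Tor (fine n M)) →L[ℝ] EuclideanSpace ℝ (Tor (fine n M)) →L[ℝ] ℝ}
    {D : EuclideanSpace ℝ (Tor (fine n M)) →L[ℝ] EuclideanSpace ℝ (Tor M)}
    (hQ : ∀ x y, Q x y = ofLp x ⬝ᵥ
      (((1 / (n : ℝ) ^ d) • ((reM (GradOp (fine n M) (n : ℂ)))ᵀ * reM (GradOp (fine n M) (n : ℂ)))) *ᵥ ofLp y))
    {H T : EuclideanSpace ℝ (Tor M) →L[ℝ] EuclideanSpace ℝ (Tor (fine n M))}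
    (hH : ∀ g, D (H g) = g) (hHo : ∀ g κ, D κ = 0 → Q (H g) κ = 0) (hT : ∀ g, D (T g) = g)
    (g : EuclideanSpace ℝ (Tor M)) : (Q.bilinearComp H H) g g ≤ (Q.bilinearComp T T) g g := by
  rw [ContinuousLinearMap.bilinearComp_apply Q T T]
  exact critical_le_of_fibre n M hQ hH hHo g (hT g)

/-- **THE TRANSPORTED FORM ALONG `H` IS THE CONSTRAINED INFIMUM**: `(Q.bilinearComp H H) g g = ⨅ x : {x ∕∕ D x = g}, Q x x` —
`…ConstrainedSchurForm`'s hard-constraint Schur form `w ↦ inf {Q δ : D δ = w}`, here ATTAINED at `H g`. [folklore] -/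
theorem critical_eq_iInf
    {Q : EuclideanSpace ℝ (Tor (fine n M)) →L[ℝ] EuclideanSpace ℝ (Tor (fine n M)) →L[ℝ] ℝ}
    {D : EuclideanSpace ℝ (Tor (fine n M)) →L[ℝ] EuclideanSpace ℝ (Tor M)}
    (hQ : ∀ x y, Q x y = ofLp x ⬝ᵥ
      (((1 / (n : ℝ) ^ d) • ((reM (GradOp (fine n M) (n : ℂ)))ᵀ * reM (GradOp (fine n M) (n : ℂ)))) *ᵥ ofLp y))
    {H : EuclideanSpace ℝ (Tor M) →L[ℝ] EuclideanSpace ℝ (Tor (fine n M))}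
    (hH : ∀ g, D (H g) = g) (hHo : ∀ g κ, D κ = 0 → Q (H g) κ = 0) (g : EuclideanSpace ℝ (Tor M)) :
    (Q.bilinearComp H H) g g = ⨅ x : {x : EuclideanSpace ℝ (Tor (fine n M)) // D x = g}, Q x.1 x.1 := by
  haveI : Nonempty {x : EuclideanSpace ℝ (Tor (fine n M)) // D x = g} := ⟨⟨H g, hH g⟩⟩
  refine le_antisymm (le_ciInf fun x => critical_le_of_fibre n M hQ hH hHo g x.2) ?_
  have hb : BddBelow (Set.range fun x : {x : EuclideanSpace ℝ (Tor (fine n M)) // D x = g} => Q x.1 x.1) :=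
    ⟨0, by rintro _ ⟨x, rfl⟩; exact fineForm_nonneg n M hQ _⟩
  have h := ciInf_le hb ⟨H g, hH g⟩
  rw [ContinuousLinearMap.bilinearComp_apply]
  exact h

/-! ## §4. The reference flow's letters by value at every composite level, along the critical section -/

section Composite

variable (L : ℕ) [NeZero L] (M' : Fin d → ℕ) [hM' : ∀ μ, NeZero (M' μ)]

/-- THE FLOOR for a given critical (indeed any) section: `D₂ g = 0 ⟹ (2∕L²)‖g‖² ≤ (Q.bilinearComp H H) g g` on `Tor (fine n (fine L M′))`
(BAKF `hardFlow_nextFloor_of_section` at `T := H`, the factor `1` removed). [folklore] -/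
theorem criticalFlow_nextFloor
    {Q : EuclideanSpace ℝ (Tor (fine n (fine L M'))) →L[ℝ] EuclideanSpace ℝ (Tor (fine n (fine L M'))) →L[ℝ] ℝ}
    {R : EuclideanSpace ℝ (Tor (fine L M')) →L[ℝ] EuclideanSpace ℝ (Tor (fine L M')) →L[ℝ] ℝ}
    {D : EuclideanSpace ℝ (Tor (fine n (fine L M'))) →L[ℝ] EuclideanSpace ℝ (Tor (fine L M'))}
    {H : EuclideanSpace ℝ (Tor (fine L M')) →L[ℝ] EuclideanSpace ℝ (Tor (fine n (fine L M')))}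
    {D₂ : EuclideanSpace ℝ (Tor (fine L M')) →L[ℝ] EuclideanSpace ℝ (Tor M')}
    (hQ : ∀ x y, Q x y = ofLp x ⬝ᵥ
      (((1 / (n : ℝ) ^ d) • ((reM (GradOp (fine n (fine L M')) (n : ℂ)))ᵀ * reM (GradOp (fine n (fine L M')) (n : ℂ)))) *ᵥ ofLp y))
    (hR : ∀ g h, R g h = ofLp g ⬝ᵥ (((reM (GradOp (fine L M') 1))ᵀ * reM (GradOp (fine L M') 1)) *ᵥ ofLp h))
    (hD : ∀ x, ofLp (D x) = reM (QsOp n (fine L M')) *ᵥ ofLp x) (hH : ∀ g, D (H g) = g)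
    (hD₂ : ∀ g, ofLp (D₂ g) = reM (QsOp L M') *ᵥ ofLp g)
    (g : EuclideanSpace ℝ (Tor (fine L M'))) (hg : D₂ g = 0) :
    2 / (L : ℝ) ^ 2 * ‖g‖ ^ 2 ≤ (Q.bilinearComp H H) g g := by
  simpa only [one_mul] using hardFlow_nextFloor_of_section L M' n hQ hR hD hH hD₂ g hg

/-- **THE REFERENCE FLOW's LETTERS BY VALUE, LEVEL-FREE.**  On `E = EuclideanSpace ℝ (Tor (fine n (fine L M′)))` (ANY `n ≥ 1` — the composite
`n = L^k` of `k` hard steps), `F = EuclideanSpace ℝ (Tor (fine L M′))`, for `Q`, `R`, `D`, `D₂` characterised in coordinates by BADD's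
fine matrix, the unit-lattice Dirichlet matrix, `reM Q′_n` and `reM Q′_L`, THERE IS a critical section `H` of `D` (`D (H g) = g`,
`Q (H g)|_{ker D} = 0`) and along it: the next-kernel floor `D₂ g = 0 ⟹ (2∕L²)‖g‖² ≤ (Q.bilinearComp H H) g g`, the lower domination
`R g g ≤ (Q.bilinearComp H H) g g` (`γ₀ = 1`), and least energy `(Q.bilinearComp H H) g g ≤ (Q.bilinearComp T T) g g` against every section
`T` — the free scalar hard step's EFFECTIVE form on print's torus with its floor letters, no `n`, no volume, no `d` in the constants. [folklore] -/
theorem exists_criticalSection_letters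
    {Q : EuclideanSpace ℝ (Tor (fine n (fine L M'))) →L[ℝ] EuclideanSpace ℝ (Tor (fine n (fine L M'))) →L[ℝ] ℝ}
    {R : EuclideanSpace ℝ (Tor (fine L M')) →L[ℝ] EuclideanSpace ℝ (Tor (fine L M')) →L[ℝ] ℝ}
    {D : EuclideanSpace ℝ (Tor (fine n (fine L M'))) →L[ℝ] EuclideanSpace ℝ (Tor (fine L M'))}
    {D₂ : EuclideanSpace ℝ (Tor (fine L M')) →L[ℝ] EuclideanSpace ℝ (Tor M')}
    (hQ : ∀ x y, Q x y = ofLp x ⬝ᵥ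
      (((1 / (n : ℝ) ^ d) • ((reM (GradOp (fine n (fine L M')) (n : ℂ)))ᵀ * reM (GradOp (fine n (fine L M')) (n : ℂ)))) *ᵥ ofLp y))
    (hR : ∀ g h, R g h = ofLp g ⬝ᵥ (((reM (GradOp (fine L M') 1))ᵀ * reM (GradOp (fine L M') 1)) *ᵥ ofLp h))
    (hD : ∀ x, ofLp (D x) = reM (QsOp n (fine L M')) *ᵥ ofLp x)
    (hD₂ : ∀ g, ofLp (D₂ g) = reM (QsOp L M') *ᵥ ofLp g) :
    ∃ H : EuclideanSpace ℝ (Tor (fine L M')) →L[ℝ] EuclideanSpace ℝ (Tor (fine n (fine L M'))),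
      (∀ g, D (H g) = g) ∧ (∀ g κ, D κ = 0 → Q (H g) κ = 0) ∧
      (∀ g, D₂ g = 0 → 2 / (L : ℝ) ^ 2 * ‖g‖ ^ 2 ≤ (Q.bilinearComp H H) g g) ∧
      (∀ g, R g g ≤ (Q.bilinearComp H H) g g) ∧
      (∀ (T : EuclideanSpace ℝ (Tor (fine L M')) →L[ℝ] EuclideanSpace ℝ (Tor (fine n (fine L M')))),
        (∀ g, D (T g) = g) → ∀ g, (Q.bilinearComp H H) g g ≤ (Q.bilinearComp T T) g g) := by
  obtain ⟨H, hH, hHo⟩ := exists_criticalSection n (fine L M') hQ hD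
  exact ⟨H, hH, hHo, criticalFlow_nextFloor n L M' hQ hR hD hH hD₂, transported_dominates_of_section n (fine L M') hQ hR hD hH,
    fun T hT g => critical_le_transported n (fine L M') hQ hH hHo hT g⟩

/-! ## §5. HSMO's reference-flow letter inhabited: the interacting hard step's next floor from one domination letter -/

/-- **THE INTERACTING HARD STEP's NEXT FLOOR ON PRINT's TORUS FROM ONE DOMINATION LETTER.**  `Q`, `R`, `D`, `D₂` as in §4; `V` ANY continuous
bilinear form on `E` with `γ₀·Q v v ≤ V v v` for all `v` (`0 ≤ γ₀`: the interacting Hessian dominates `γ₀` times the free fine Dirichlet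
form — the shape of print's (1.67) input «`Δ_k ≥ γ₀(−Δ)`» at the fine level); `T` ANY continuous right inverse of `D` ⟹
`D₂ g = 0 ⟹ γ₀·(2∕L²)·‖g‖² ≤ (V.bilinearComp T T) g g` — `…HardStepMonotone.kerCoercive_of_dominates_reference` with `P := Q`, its
`P`-critical section `H :=` §2 and its reference floor `hcoP :=` §4, every reference-side slot inhabited on print's objects. [folklore] -/
theorem interacting_nextFloor_of_domination
    {Q : EuclideanSpace ℝ (Tor (fine n (fine L M'))) →L[ℝ] EuclideanSpace ℝ (Tor (fine n (fine L M'))) →L[ℝ] ℝ}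
    {R : EuclideanSpace ℝ (Tor (fine L M')) →L[ℝ] EuclideanSpace ℝ (Tor (fine L M')) →L[ℝ] ℝ}
    {D : EuclideanSpace ℝ (Tor (fine n (fine L M'))) →L[ℝ] EuclideanSpace ℝ (Tor (fine L M'))}
    {D₂ : EuclideanSpace ℝ (Tor (fine L M')) →L[ℝ] EuclideanSpace ℝ (Tor M')}
    (hQ : ∀ x y, Q x y = ofLp x ⬝ᵥ
      (((1 / (n : ℝ) ^ d) • ((reM (GradOp (fine n (fine L M')) (n : ℂ)))ᵀ * reM (GradOp (fine n (fine L M')) (n : ℂ)))) *ᵥ ofLp y))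
    (hR : ∀ g h, R g h = ofLp g ⬝ᵥ (((reM (GradOp (fine L M') 1))ᵀ * reM (GradOp (fine L M') 1)) *ᵥ ofLp h))
    (hD : ∀ x, ofLp (D x) = reM (QsOp n (fine L M')) *ᵥ ofLp x)
    (hD₂ : ∀ g, ofLp (D₂ g) = reM (QsOp L M') *ᵥ ofLp g)
    {V : EuclideanSpace ℝ (Tor (fine n (fine L M'))) →L[ℝ] EuclideanSpace ℝ (Tor (fine n (fine L M'))) →L[ℝ] ℝ}
    {γ₀ : ℝ} (hγ₀ : 0 ≤ γ₀) (hdom : ∀ v, γ₀ * Q v v ≤ V v v)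
    {T : EuclideanSpace ℝ (Tor (fine L M')) →L[ℝ] EuclideanSpace ℝ (Tor (fine n (fine L M')))} (hT : ∀ g, D (T g) = g) :
    ∀ g, D₂ g = 0 → γ₀ * (2 / (L : ℝ) ^ 2) * ‖g‖ ^ 2 ≤ (V.bilinearComp T T) g g := by
  obtain ⟨H, hH, hHo⟩ := exists_criticalSection n (fine L M') hQ hD
  exact kerCoercive_of_dominates_reference V Q D T H hT hH hHo (fineForm_symm n (fine L M') hQ)
    (fun κ _ => fineForm_nonneg n (fine L M') hQ κ) hγ₀ hdom D₂ (criticalFlow_nextFloor n L M' hQ hR hD hH hD₂)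

/-- **WITH EVERY LETTER DISCHARGED**: `Q`, `R`, `D`, `D₂` EXIST with the four coordinate characterisations (`…MatrixFormJunction.exists_form ∕
exists_map`), together with a critical section `H` of `D` carrying §4's three letters. [folklore] -/
theorem exists_criticalFlow_letters :
    ∃ (Q : EuclideanSpace ℝ (Tor (fine n (fine L M'))) →L[ℝ] EuclideanSpace ℝ (Tor (fine n (fine L M'))) →L[ℝ] ℝ)
      (R : EuclideanSpace ℝ (Tor (fine L M')) →L[ℝ] EuclideanSpace ℝ (Tor (fine L M')) →L[ℝ] ℝ)
      (D : EuclideanSpace ℝ (Tor (fine n (fine L M'))) →L[ℝ] EuclideanSpace ℝ (Tor (fine L M')))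
      (D₂ : EuclideanSpace ℝ (Tor (fine L M')) →L[ℝ] EuclideanSpace ℝ (Tor M'))
      (H : EuclideanSpace ℝ (Tor (fine L M')) →L[ℝ] EuclideanSpace ℝ (Tor (fine n (fine L M')))),
      (∀ x y, Q x y = ofLp x ⬝ᵥ
        (((1 / (n : ℝ) ^ d) • ((reM (GradOp (fine n (fine L M')) (n : ℂ)))ᵀ * reM (GradOp (fine n (fine L M')) (n : ℂ)))) *ᵥ ofLp y)) ∧
      (∀ g h, R g h = ofLp g ⬝ᵥ (((reM (GradOp (fine L M') 1))ᵀ * reM (GradOp (fine L M') 1)) *ᵥ ofLp h)) ∧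
      (∀ x, ofLp (D x) = reM (QsOp n (fine L M')) *ᵥ ofLp x) ∧
      (∀ g, ofLp (D₂ g) = reM (QsOp L M') *ᵥ ofLp g) ∧
      (∀ g, D (H g) = g) ∧ (∀ g κ, D κ = 0 → Q (H g) κ = 0) ∧
      (∀ g, D₂ g = 0 → 2 / (L : ℝ) ^ 2 * ‖g‖ ^ 2 ≤ (Q.bilinearComp H H) g g) ∧
      (∀ g, R g g ≤ (Q.bilinearComp H H) g g) ∧
      (∀ (T : EuclideanSpace ℝ (Tor (fine L M')) →L[ℝ] EuclideanSpace ℝ (Tor (fine n (fine L M')))),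
        (∀ g, D (T g) = g) → ∀ g, (Q.bilinearComp H H) g g ≤ (Q.bilinearComp T T) g g) := by
  classical
  obtain ⟨Q, hQ⟩ := MatrixFormJunction.exists_form (ι := Tor (fine n (fine L M')))
    ((1 / (n : ℝ) ^ d) • ((reM (GradOp (fine n (fine L M')) (n : ℂ)))ᵀ * reM (GradOp (fine n (fine L M')) (n : ℂ))))
  obtain ⟨R, hR⟩ := MatrixFormJunction.exists_form (ι := Tor (fine L M')) ((reM (GradOp (fine L M') 1))ᵀ * reM (GradOp (fine L M') 1))
  obtain ⟨D, hD⟩ := MatrixFormJunction.exists_map (ι := Tor (fine n (fine L M'))) (κ := Tor (fine L M')) (reM (QsOp n (fine L M')))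
  obtain ⟨D₂, hD₂⟩ := MatrixFormJunction.exists_map (ι := Tor (fine L M')) (κ := Tor M') (reM (QsOp L M'))
  obtain ⟨H, hH, hHo, hfl, hdom, hle⟩ := exists_criticalSection_letters n L M' hQ hR hD hD₂
  exact ⟨Q, R, D, D₂, H, hQ, hR, hD, hD₂, hH, hHo, hfl, hdom, hle⟩

end Composite

/-! ## §6. Toy -/

/-- Toy: the kernel-coercivity constant `2∕n^d` of §1 is `1∕8` at `n = 2`, `d = 4`, and the interacting next floor `γ₀·(2∕L²)` of §5 is
`1∕2` at `γ₀ = 1`, `L = 2`. -/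
example : (2 : ℝ) / (2 : ℕ) ^ 4 = 1 / 8 ∧ (1 : ℝ) * (2 / (2 : ℕ) ^ 2) = 1 / 2 := by norm_num

end Summit.QuantumFields.BalabanUV.T4Continuum.NE7b.BlockAverageCriticalSection
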